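import Literature.NumberTheory.BeurlingPrimes.BDRMultisetZeta
import HarnessLib

/-!
# BDR Theorem 3.2, the bound `Z(σ+it) ≪ σ/(σ − 1/2) + σ√(log(|t|+1)/(σ − 1/2))` for `σ > 1/2`

Topic `Literature/NumberTheory/BeurlingPrimes`, grouping namespace `BDRMultiset`. Everything in this file is PROVED.

Broucke–Debruyne–Révész (2023), proof of Theorem 3.2, (3.4): "The modulus of `Z(s)` is not well-controlled
automatically. More precisely, here we need a recourse to the full strength of the error estimates furnished by
Theorem 1.2 … `Z(s) = ℳ{dΠ_𝒫 − dπ_𝒫; s} + ℳ{dπ_𝒫 − dF; s} − ℳ{dG − dF; s}` … Collecting the above estimates we arrive at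
(3.4)". The three-term decomposition with its bounds is the tree's `BV.Z f g P` (`BVContinuation.lean`,
`BV.norm_Z_le`, written for Broucke–Vindas' Theorem 3.1). That file requires a prime template density bounded by `2`;
the BDR density `f = F′` is only `≤ C_F/log u`, so we apply it to the truncation `f_a = f·1_{(u₀,∞)}`,
`u₀ = e^{C_F/2}`, with the companion `g_a = g − (f − f_a)` (same difference `g_a − f_a = g − f`), at the cost of the
entire correction `V(s) = ∫_1^{u₀} f(u) u^{−s} du` and of the constant in (1.3). Main results (template data of
Theorem 3.2 with `NF ≥ 0`, `|π_𝒫 − F| ≤ A'`, (1.3) in the form `BV.Approx f 𝒫 A`, and `|Π_𝒫 − G| ≤ C(1 + log x)`):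

* `fTrunc`, `gTrunc`, `Vfn` and their bookkeeping (`abs_fTrunc_le_two`, `approx_fTrunc`, `gTrunc_sub_fTrunc`,
  `differentiable_Vfn`, `norm_Vfn_le`);
* `Zfn_eq_tsum_log_sub_integral` — `Z(s) = Σ_j log((1 − λ_j^{−s})⁻¹) − ∫_1^∞ g(u)u^{−s} du` (`σ > 1`) and
  `Zfn_eq_bvZ_sub_Vfn` — **`Z = BV.Z f_a g_a 𝒫 − V` on `σ > 1/2`** (equality on `σ > 1`, identity theorem);
* `norm_Zfn_le` — **(3.4): one constant `C` with `‖Z(σ+it)‖ ≤ C(σ/(σ−1/2) + σ√(log(|t|+1)/(σ−1/2)))` for all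
  `σ > 1/2`, `t ∈ ℝ`** (`σ ≤ 2` from `BV.norm_Z_le`, `σ > 2` from absolute convergence).

## References
* [BrouckeDebruyneRevesz2023] F. Broucke, G. Debruyne, Sz. Gy. Révész, *Some examples of well-behaved Beurling
  number systems*, arXiv:2309.01567, proof of Theorem 3.2 (from "The modulus of Z(s)" to "(3.4)") (read).
* [BrouckeVindas2024] F. Broucke, J. Vindas, Math. Z. 307 (2024), proof of Theorem 3.1 (tree `BVContinuation.lean`).
-/

noncomputable section

open Filter Topology Complex Set MeasureTheory intervalIntegral Asymptotics
open scoped ComplexConjugate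

namespace Literature.NumberTheory.BeurlingPrimes

open Literature.Barriers.RiemannHypothesis

namespace BDRMultiset

variable {R S : Multiset ℂ} {δ : ℝ} {M : ℕ} {P : BeurlingPrimes} {A : ℝ}

/-! ### The truncated densities -/

variable (R S M) in
/-- `C_F = 1 + (3 + 2H)(1 + |𝒮| + |ℛ|) + M`, the constant of `densF ≤ C_F/log u`. [folklore] -/
def CFc : ℝ := 1 + (3 + 2 * Hc R S) * (1 + Multiset.card S + Multiset.card R) + M

variable (R S M) in
/-- `C_glob = BQe^Q + C_F`, the global bound for `|densF|`. [folklore] -/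
def Cglob : ℝ := sizeBound R S M * normBound R S * Real.exp (normBound R S) + CFc R S M

variable (R S M) in
/-- The truncation point `u₀ = exp(C_F/2)` (so that `densF ≤ 2` on `(u₀, ∞)`). [folklore] -/
def u0 : ℝ := Real.exp (CFc R S M / 2)

variable (R S δ M) in
/-- The truncated prime template density `f_a = densF · 1_{(u₀,∞)}`. [cite: BrouckeDebruyneRevesz2023, proof of Theorem 3.2] -/
def fTrunc (u : ℝ) : ℝ := if u0 R S M < u then densF R S δ M u else 0

variable (R S δ M) in
/-- The companion `g_a = densG − (densF − f_a)`. [cite: BrouckeDebruyneRevesz2023, proof of Theorem 3.2] -/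
def gTrunc (u : ℝ) : ℝ := densG R S δ M u - densF R S δ M u + fTrunc R S δ M u

variable (R S δ M) in
/-- The correction `V(s) = ∫_{(1,u₀]} densF(u) u^{−s} du`. [cite: BrouckeDebruyneRevesz2023, proof of Theorem 3.2] -/
def Vfn (s : ℂ) : ℂ := ∫ u in Ioc 1 (u0 R S M), (densF R S δ M u : ℂ) * (u : ℂ) ^ (-s)

/-- `1 ≤ C_F`. [folklore] -/
theorem one_le_CFc : 1 ≤ CFc R S M := by
  unfold CFc
  have hH := one_le_Hc R S
  have : 0 ≤ (3 + 2 * Hc R S) * (1 + Multiset.card S + Multiset.card R) + (M : ℝ) := by positivity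
  linarith

/-- `0 ≤ C_glob`. [folklore] -/
theorem Cglob_nonneg : 0 ≤ Cglob R S M := by
  unfold Cglob
  have := one_le_CFc (R := R) (S := S) (M := M)
  have hB := sizeBound_nonneg (R := R) (S := S) (M := M)
  have hQ := normBound_nonneg (R := R) (S := S)
  positivity

/-- `1 < u₀`. [folklore] -/
theorem one_lt_u0 : 1 < u0 R S M := by
  unfold u0
  have := one_le_CFc (R := R) (S := S) (M := M)
  exact Real.one_lt_exp_iff.2 (by positivity)

/-- `log u₀ = C_F/2`. [folklore] -/
theorem log_u0 : Real.log (u0 R S M) = CFc R S M / 2 := by rw [u0, Real.log_exp]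

/-- **`|f_a(v)| ≤ 2` for `v > 1`** (`densF ≤ C_F/log v < 2` beyond `u₀`, and `densF ≥ 0`). [cite: BrouckeDebruyneRevesz2023, proof of Theorem 3.2] -/
theorem abs_fTrunc_le_two (hS : ∀ ω ∈ S, ω.re ≤ 1) (hR : ∀ ρ ∈ R, ρ.re ≤ 1) (hδ : 0 ≤ δ) (hδ1 : δ ≤ 1)
    (hpos : ∀ L : ℝ, 0 < L → 0 ≤ NF R S δ M L) (v : ℝ) (hv : 1 < v) : |fTrunc R S δ M v| ≤ 2 := by
  unfold fTrunc
  split_ifs with h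
  · have h0 := densF_nonneg hpos v
    have h1 := densF_le_div_log (M := M) hS hR hδ hδ1 hv
    have hCF : CFc R S M = 1 + (3 + 2 * Hc R S) * (1 + Multiset.card S + Multiset.card R) + M := rfl
    rw [← hCF] at h1
    have hlog : CFc R S M / 2 < Real.log v := by
      rw [← log_u0 (R := R) (S := S) (M := M)]
      exact Real.log_lt_log (lt_trans one_pos one_lt_u0) h
    have hlogpos : 0 < Real.log v := Real.log_pos hv
    have hC := one_le_CFc (R := R) (S := S) (M := M)
    have h2 : CFc R S M / Real.log v ≤ 2 := by
      rw [div_le_iff₀ hlogpos]; linarith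
    rw [abs_of_nonneg h0]; linarith
  · simp

/-- `f_a` is measurable. [folklore] -/
theorem measurable_fTrunc (hδ : 0 ≤ δ) (hδ1 : δ ≤ 1) : Measurable (fTrunc R S δ M) :=
  Measurable.ite measurableSet_Ioi (measurable_densF hδ hδ1) measurable_const

/-- `g_a` is measurable. [folklore] -/
theorem measurable_gTrunc (hδ : 0 ≤ δ) (hδ1 : δ ≤ 1) : Measurable (gTrunc R S δ M) :=
  ((measurable_densG hδ hδ1).sub (measurable_densF hδ hδ1)).add (measurable_fTrunc hδ hδ1)

/-- `g_a − f_a = densG − densF`. [folklore] -/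
theorem gTrunc_sub_fTrunc (u : ℝ) : gTrunc R S δ M u - fTrunc R S δ M u = densG R S δ M u - densF R S δ M u := by
  unfold gTrunc; ring

/-- The hypothesis `hgf` of `BVContinuation.lean` for `(f_a, g_a)`. [cite: BrouckeDebruyneRevesz2023, proof of Theorem 3.2] -/
theorem gTrunc_sub_fTrunc_bounds (hS : ∀ ω ∈ S, ω.re ≤ 1) (hR : ∀ ρ ∈ R, ρ.re ≤ 1) (hδ : 0 ≤ δ) (hδ1 : δ ≤ 1)
    (hpos : ∀ L : ℝ, 0 < L → 0 ≤ NF R S δ M L) (u : ℝ) (hu : 1 < u) :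
    0 ≤ gTrunc R S δ M u - fTrunc R S δ M u ∧
      gTrunc R S δ M u - fTrunc R S δ M u ≤ Cglob R S M * u ^ (-(1 / 2 : ℝ)) := by
  rw [gTrunc_sub_fTrunc]
  exact densG_sub_densF_bounds hS hR hδ hδ1 hpos hu

/-- `|densF u − f_a u| ≤ C_glob · 1_{u ≤ u₀}`: the difference vanishes beyond `u₀` and is bounded by `C_glob`. [folklore] -/
theorem abs_densF_sub_fTrunc_le (hS : ∀ ω ∈ S, ω.re ≤ 1) (hR : ∀ ρ ∈ R, ρ.re ≤ 1) (hδ : 0 ≤ δ) (hδ1 : δ ≤ 1)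
    (hpos : ∀ L : ℝ, 0 < L → 0 ≤ NF R S δ M L) (u : ℝ) :
    |densF R S δ M u - fTrunc R S δ M u| ≤ Cglob R S M ∧ (u0 R S M < u → densF R S δ M u - fTrunc R S δ M u = 0) := by
  unfold fTrunc
  split_ifs with h
  · simp [Cglob_nonneg]
  · refine ⟨?_, fun h' ↦ absurd h' h⟩
    rw [sub_zero]
    exact abs_densF_le hS hR hδ hδ1 (fun _ hx ↦ hpos _ (Real.log_pos hx)) u

/-- Interval integrability on `[1, x]` of `u ↦ φ(u) u^{−it}` for a measurable `φ` with `|φ| ≤ B`. [folklore] -/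
theorem intervalIntegrable_mul_cpow_of_bounded {φ : ℝ → ℝ} {B : ℝ} (hφm : Measurable φ) (hφb : ∀ u, |φ u| ≤ B)
    (t : ℝ) {x : ℝ} (hx : 1 ≤ x) :
    IntervalIntegrable (fun u : ℝ ↦ (φ u : ℂ) * (u : ℂ) ^ (-(t * I))) volume 1 x := by
  rw [intervalIntegrable_iff_integrableOn_Ioc_of_le hx]
  refine Measure.integrableOn_of_bounded (M := B) measure_Ioc_lt_top.ne ?_ ?_
  · exact ((Complex.measurable_ofReal.comp hφm).mul ((Complex.measurable_ofReal.comp measurable_id).pow_const _)).aestronglyMeasurable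
  · refine ae_restrict_of_forall_mem measurableSet_Ioc fun u hu ↦ ?_
    have hu0 : 0 < u := lt_trans one_pos hu.1
    rw [norm_mul, norm_cpow_neg_mul_I hu0, mul_one, Complex.norm_real, Real.norm_eq_abs]
    exact hφb u

/-- **(1.3) for the truncated density**: `BV.Approx densF 𝒫 A` implies `BV.Approx f_a 𝒫 (A + C_glob(u₀ − 1))`
(`‖S_{densF}(x,t) − S_{f_a}(x,t)‖ ≤ ∫_1^{min(x,u₀)} |densF| ≤ C_glob(u₀−1) ≤ C_glob(u₀−1)·gauge`). [cite: BrouckeDebruyneRevesz2023, proof of Theorem 3.2] -/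
theorem approx_fTrunc (hS : ∀ ω ∈ S, ω.re ≤ 1) (hR : ∀ ρ ∈ R, ρ.re ≤ 1) (hδ : 0 ≤ δ) (hδ1 : δ ≤ 1)
    (hpos : ∀ L : ℝ, 0 < L → 0 ≤ NF R S δ M L) (hA : BV.Approx (densF R S δ M) P A) :
    BV.Approx (fTrunc R S δ M) P (A + Cglob R S M * (u0 R S M - 1)) := by
  intro x hx t
  have hA0 := hA.nonneg
  have hu0 := one_lt_u0 (R := R) (S := S) (M := M)
  have hCg := Cglob_nonneg (R := R) (S := S) (M := M)
  have h1 := hA x hx t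
  have hglobF : ∀ u, |densF R S δ M u| ≤ Cglob R S M := fun u ↦
    abs_densF_le hS hR hδ hδ1 (fun _ hy ↦ hpos _ (Real.log_pos hy)) u
  have hglobT : ∀ u, |fTrunc R S δ M u| ≤ Cglob R S M := fun u ↦ by
    unfold fTrunc; split_ifs
    · exact hglobF u
    · simp [hCg]
  -- the difference of the template sums as one integral
  set φ : ℝ → ℝ := fun u ↦ densF R S δ M u - fTrunc R S δ M u with hφ
  have hφm : Measurable φ := (measurable_densF hδ hδ1).sub (measurable_fTrunc hδ hδ1)
  have hφb : ∀ u, |φ u| ≤ Cglob R S M := fun u ↦ (abs_densF_sub_fTrunc_le hS hR hδ hδ1 hpos u).1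
  have hφ0 : ∀ u, u0 R S M < u → φ u = 0 := fun u hu ↦ (abs_densF_sub_fTrunc_le hS hR hδ hδ1 hpos u).2 hu
  have hint : ∀ y : ℝ, 1 ≤ y → IntervalIntegrable (fun u : ℝ ↦ (φ u : ℂ) * (u : ℂ) ^ (-(t * I))) volume 1 y :=
    fun y hy ↦ intervalIntegrable_mul_cpow_of_bounded hφm hφb t hy
  have hdiff : BV.tmplSum (densF R S δ M) x t - BV.tmplSum (fTrunc R S δ M) x t =
      ∫ u in (1 : ℝ)..x, (φ u : ℂ) * (u : ℂ) ^ (-(t * I)) := by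
    have hI1 : IntervalIntegrable (BV.tmplIntegrand (densF R S δ M) t) volume 1 x :=
      intervalIntegrable_mul_cpow_of_bounded (measurable_densF hδ hδ1) hglobF t hx
    have hI2 : IntervalIntegrable (BV.tmplIntegrand (fTrunc R S δ M) t) volume 1 x :=
      intervalIntegrable_mul_cpow_of_bounded (measurable_fTrunc hδ hδ1) hglobT t hx
    rw [BV.tmplSum, BV.tmplSum, ← intervalIntegral.integral_sub hI1 hI2]
    refine intervalIntegral.integral_congr fun u _ ↦ ?_
    simp only [BV.tmplIntegrand, hφ]; push_cast; ring
  -- its norm is at most `C_glob (u₀ − 1)`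
  have hnorm : ‖∫ u in (1 : ℝ)..x, (φ u : ℂ) * (u : ℂ) ^ (-(t * I))‖ ≤ Cglob R S M * (u0 R S M - 1) := by
    set m : ℝ := min x (u0 R S M) with hm
    have hm1 : 1 ≤ m := le_min hx hu0.le
    have hmx : m ≤ x := min_le_left _ _
    have hsplit : ∫ u in (1 : ℝ)..x, (φ u : ℂ) * (u : ℂ) ^ (-(t * I)) =
        (∫ u in (1 : ℝ)..m, (φ u : ℂ) * (u : ℂ) ^ (-(t * I))) + ∫ u in m..x, (φ u : ℂ) * (u : ℂ) ^ (-(t * I)) := by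
      rw [intervalIntegral.integral_add_adjacent_intervals (hint m hm1)]
      exact (hint x hx).mono_set (by rw [uIcc_of_le hmx, uIcc_of_le hx]; exact Icc_subset_Icc hm1 le_rfl)
    have hzero : ∫ u in m..x, (φ u : ℂ) * (u : ℂ) ^ (-(t * I)) = 0 := by
      rcases le_or_gt x (u0 R S M) with hxu | hxu
      · rw [hm, min_eq_left hxu, intervalIntegral.integral_same]
      · rw [hm, min_eq_right hxu.le, intervalIntegral.integral_of_le hxu.le]
        refine setIntegral_eq_zero_of_forall_eq_zero fun u hu ↦ ?_
        rw [hφ0 u hu.1]; simp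
    rw [hsplit, hzero, add_zero]
    have hb := intervalIntegral.norm_integral_le_of_norm_le_const (a := 1) (b := m) (C := Cglob R S M)
      (f := fun u : ℝ ↦ (φ u : ℂ) * (u : ℂ) ^ (-(t * I))) fun u hu ↦ by
        rw [uIoc_of_le hm1] at hu
        have hu0' : 0 < u := lt_trans one_pos hu.1
        rw [norm_mul, norm_cpow_neg_mul_I hu0', mul_one, Complex.norm_real, Real.norm_eq_abs]
        exact hφb u
    rw [abs_of_nonneg (by linarith : (0:ℝ) ≤ m - 1)] at hb
    refine hb.trans (mul_le_mul_of_nonneg_left ?_ hCg)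
    linarith [min_le_right x (u0 R S M)]
  -- gauge ≥ 1
  have hgauge : 1 ≤ BV.gauge x t := by
    have h1 : 1 ≤ Real.sqrt x := by rw [Real.le_sqrt zero_le_one (by linarith)]; linarith
    exact h1.trans (BV.sqrt_le_gauge x t)
  have heq : P.primeSum x t - BV.tmplSum (fTrunc R S δ M) x t = (P.primeSum x t - BV.tmplSum (densF R S δ M) x t) +
      (BV.tmplSum (densF R S δ M) x t - BV.tmplSum (fTrunc R S δ M) x t) := by ring
  rw [heq]
  calc ‖(P.primeSum x t - BV.tmplSum (densF R S δ M) x t) + (BV.tmplSum (densF R S δ M) x t - BV.tmplSum (fTrunc R S δ M) x t)‖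
      ≤ ‖P.primeSum x t - BV.tmplSum (densF R S δ M) x t‖ + ‖BV.tmplSum (densF R S δ M) x t - BV.tmplSum (fTrunc R S δ M) x t‖ :=
        norm_add_le _ _
    _ ≤ A * BV.gauge x t + Cglob R S M * (u0 R S M - 1) := by rw [hdiff]; exact add_le_add h1 hnorm
    _ ≤ (A + Cglob R S M * (u0 R S M - 1)) * BV.gauge x t := by
        have : 0 ≤ Cglob R S M * (u0 R S M - 1) := mul_nonneg hCg (by linarith)
        nlinarith

/-! ### The correction `V` -/

/-- `densF u · u^{−s}` is integrable on `(1, u₀]` (bounded on a finite interval). [folklore] -/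
theorem integrableOn_densF_mul_cpow_Ioc (hS : ∀ ω ∈ S, ω.re ≤ 1) (hR : ∀ ρ ∈ R, ρ.re ≤ 1) (hδ : 0 ≤ δ) (hδ1 : δ ≤ 1)
    (hpos : ∀ L : ℝ, 0 < L → 0 ≤ NF R S δ M L) (s : ℂ) :
    IntegrableOn (fun u : ℝ ↦ (densF R S δ M u : ℂ) * (u : ℂ) ^ (-s)) (Ioc 1 (u0 R S M)) := by
  have hu0 := one_lt_u0 (R := R) (S := S) (M := M)
  have hglobF : ∀ u, |densF R S δ M u| ≤ Cglob R S M := fun u ↦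
    abs_densF_le hS hR hδ hδ1 (fun _ hy ↦ hpos _ (Real.log_pos hy)) u
  refine Measure.integrableOn_of_bounded (M := Cglob R S M * max 1 ((u0 R S M) ^ (-s.re))) measure_Ioc_lt_top.ne ?_ ?_
  · exact ((Complex.measurable_ofReal.comp (measurable_densF hδ hδ1)).mul
      ((Complex.measurable_ofReal.comp measurable_id).pow_const _)).aestronglyMeasurable
  · refine ae_restrict_of_forall_mem measurableSet_Ioc fun u hu ↦ ?_
    have hu0' : 0 < u := lt_trans one_pos hu.1
    rw [norm_mul, Complex.norm_real, Real.norm_eq_abs, norm_cpow_eq_rpow_re_of_pos hu0', neg_re]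
    refine mul_le_mul (hglobF u) ?_ (Real.rpow_nonneg hu0'.le _) Cglob_nonneg
    rcases le_or_gt 0 s.re with hσ | hσ
    · exact (Real.rpow_le_one_of_one_le_of_nonpos hu.1.le (by linarith)).trans (le_max_left _ _)
    · exact (Real.rpow_le_rpow hu0'.le hu.2 (by linarith)).trans (le_max_right _ _)

/-- `‖V(s)‖ ≤ C_glob (u₀ − 1)` for `Re s ≥ 0`. [folklore] -/
theorem norm_Vfn_le (hS : ∀ ω ∈ S, ω.re ≤ 1) (hR : ∀ ρ ∈ R, ρ.re ≤ 1) (hδ : 0 ≤ δ) (hδ1 : δ ≤ 1)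
    (hpos : ∀ L : ℝ, 0 < L → 0 ≤ NF R S δ M L) {s : ℂ} (hs : 0 ≤ s.re) :
    ‖Vfn R S δ M s‖ ≤ Cglob R S M * (u0 R S M - 1) := by
  have hu0 := one_lt_u0 (R := R) (S := S) (M := M)
  have hglobF : ∀ u, |densF R S δ M u| ≤ Cglob R S M := fun u ↦
    abs_densF_le hS hR hδ hδ1 (fun _ hy ↦ hpos _ (Real.log_pos hy)) u
  have h := norm_setIntegral_le_of_norm_le_const (μ := volume) (s := Ioc 1 (u0 R S M)) (C := Cglob R S M)
    (f := fun u : ℝ ↦ (densF R S δ M u : ℂ) * (u : ℂ) ^ (-s)) measure_Ioc_lt_top fun u hu ↦ by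
      have hu0' : 0 < u := lt_trans one_pos hu.1
      rw [norm_mul, Complex.norm_real, Real.norm_eq_abs, norm_cpow_eq_rpow_re_of_pos hu0', neg_re]
      calc |densF R S δ M u| * u ^ (-s.re) ≤ Cglob R S M * 1 :=
            mul_le_mul (hglobF u) (Real.rpow_le_one_of_one_le_of_nonpos hu.1.le (by linarith)) (by positivity) Cglob_nonneg
        _ = Cglob R S M := mul_one _
  rw [Vfn]
  refine h.trans (le_of_eq ?_)
  rw [Measure.real, Real.volume_Ioc, ENNReal.toReal_ofReal (by linarith)]

/-- The kernel of `V` as a Mellin transform: `1_{(1,u₀]} (densF u · u)`. [folklore] -/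
theorem Vfn_eq_mellin (s : ℂ) :
    Vfn R S δ M s = mellin ((Ioc 1 (u0 R S M)).indicator fun u : ℝ ↦ (densF R S δ M u : ℂ) * u) (-s) := by
  rw [mellin, Vfn]
  have hf : (fun u : ℝ ↦ (u : ℂ) ^ (-s - 1) • (Ioc 1 (u0 R S M)).indicator (fun u : ℝ ↦ (densF R S δ M u : ℂ) * u) u) =
      (Ioc 1 (u0 R S M)).indicator fun u ↦ (densF R S δ M u : ℂ) * (u : ℂ) ^ (-s) := by
    funext u
    simp only [smul_eq_mul]
    by_cases hu : u ∈ Ioc 1 (u0 R S M)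
    · rw [indicator_of_mem hu, indicator_of_mem hu]
      have hu0 : (u : ℂ) ≠ 0 := ofReal_ne_zero.2 (ne_of_gt (lt_trans one_pos hu.1))
      have : (u : ℂ) ^ (-s) = (u : ℂ) ^ (-s - 1) * u := by
        rw [Complex.cpow_sub _ _ hu0, Complex.cpow_one, div_mul_cancel₀ _ hu0]
      rw [this]; ring
    · rw [indicator_of_notMem hu, indicator_of_notMem hu, mul_zero]
  rw [hf, setIntegral_indicator measurableSet_Ioc]
  congr 1
  have hset : (Ioi (0 : ℝ) ∩ Ioc 1 (u0 R S M) : Set ℝ) = Ioc 1 (u0 R S M) := by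
    ext u; constructor
    · exact fun h ↦ h.2
    · exact fun h ↦ ⟨lt_trans one_pos h.1, h⟩
  rw [hset]

/-- **`V` is entire** (Mellin transform of a bounded compactly supported function). [folklore] -/
theorem differentiable_Vfn (hS : ∀ ω ∈ S, ω.re ≤ 1) (hR : ∀ ρ ∈ R, ρ.re ≤ 1) (hδ : 0 ≤ δ) (hδ1 : δ ≤ 1)
    (hpos : ∀ L : ℝ, 0 < L → 0 ≤ NF R S δ M L) : Differentiable ℂ (Vfn R S δ M) := by
  have hu0 := one_lt_u0 (R := R) (S := S) (M := M)
  set k : ℝ → ℂ := (Ioc 1 (u0 R S M)).indicator fun u : ℝ ↦ (densF R S δ M u : ℂ) * u with hk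
  have hglobF : ∀ u, |densF R S δ M u| ≤ Cglob R S M := fun u ↦
    abs_densF_le hS hR hδ hδ1 (fun _ hy ↦ hpos _ (Real.log_pos hy)) u
  have hkm : Measurable k :=
    ((Complex.measurable_ofReal.comp (measurable_densF hδ hδ1)).mul Complex.measurable_ofReal).indicator measurableSet_Ioc
  have hkb : ∀ u, ‖k u‖ ≤ Cglob R S M * u0 R S M := by
    intro u
    rw [hk]
    by_cases hu : u ∈ Ioc 1 (u0 R S M)
    · rw [indicator_of_mem hu, norm_mul, Complex.norm_real, Complex.norm_real, Real.norm_eq_abs, Real.norm_eq_abs,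
        abs_of_pos (lt_trans one_pos hu.1)]
      exact mul_le_mul (hglobF u) hu.2 (by linarith [hu.1]) Cglob_nonneg
    · rw [indicator_of_notMem hu, norm_zero]; exact mul_nonneg Cglob_nonneg (by linarith)
  have hki : Integrable k := by
    have h1 : IntegrableOn (fun u : ℝ ↦ (densF R S δ M u : ℂ) * u) (Ioc 1 (u0 R S M)) := by
      refine Measure.integrableOn_of_bounded (M := Cglob R S M * u0 R S M) measure_Ioc_lt_top.ne ?_ ?_
      · exact ((Complex.measurable_ofReal.comp (measurable_densF hδ hδ1)).mul Complex.measurable_ofReal).aestronglyMeasurable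
      · refine ae_restrict_of_forall_mem measurableSet_Ioc fun u hu ↦ ?_
        have := hkb u
        rwa [hk, indicator_of_mem hu] at this
    exact h1.integrable_indicator measurableSet_Ioc
  have hloc : LocallyIntegrableOn k (Ioi 0) := hki.locallyIntegrable.locallyIntegrableOn _
  have htop : ∀ a : ℝ, k =O[atTop] fun u : ℝ ↦ u ^ (-a) := by
    intro a
    have h : k =ᶠ[atTop] fun _ ↦ (0 : ℂ) := by
      filter_upwards [eventually_gt_atTop (u0 R S M)] with u hu
      rw [hk, indicator_of_notMem (fun h ↦ not_le.2 hu h.2)]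
    exact (isBigO_zero _ _).congr' h.symm EventuallyEq.rfl
  have hbot : ∀ b : ℝ, k =O[𝓝[>] 0] fun u : ℝ ↦ u ^ (-b) := by
    intro b
    have h : k =ᶠ[𝓝[>] 0] fun _ ↦ (0 : ℂ) := by
      have : Ioo (0 : ℝ) 1 ∈ 𝓝[>] (0 : ℝ) := Ioo_mem_nhdsGT one_pos
      filter_upwards [this] with u hu
      rw [hk, indicator_of_notMem (fun h ↦ not_lt.2 h.1.le hu.2)]
    exact (isBigO_zero _ _).congr' h.symm EventuallyEq.rfl
  intro s
  have hdiff : DifferentiableAt ℂ (mellin k) (-s) :=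
    mellin_differentiableAt_of_isBigO_rpow hloc (htop ((-s).re + 1)) (by linarith) (hbot (-s.re - 1))
      (by simp only [neg_re]; linarith)
  have hfun : Vfn R S δ M = fun s ↦ mellin k (-s) := funext fun s ↦ Vfn_eq_mellin s
  rw [hfun]
  exact hdiff.comp s differentiableAt_id.neg

/-! ### `Z = BV.Z f_a g_a 𝒫 − V` -/

/-- `Π_𝒫(x) x^{−s−1}` is integrable on `(1,∞)` for `Re s > 1` (from `|Π_𝒫 − G| ≤ C(1 + log x)` and `|G| ≤ C_g(x−1)`).
[folklore] -/
theorem integrableOn_riemannPrimeCount_mul_cpow (hS : ∀ ω ∈ S, ω.re ≤ 1) (hR : ∀ ρ ∈ R, ρ.re ≤ 1) (hδ : 0 ≤ δ)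
    (hδ1 : δ ≤ 1) {C : ℝ} (hPiG : ∀ x : ℝ, 1 ≤ x → |P.riemannPrimeCount x - tmplG R S δ M x| ≤ C * (1 + Real.log x))
    {s : ℂ} (hs : 1 < s.re) :
    IntegrableOn (fun x : ℝ ↦ ((P.riemannPrimeCount x : ℝ) : ℂ) * (x : ℂ) ^ (-s - 1)) (Ioi 1) := by
  obtain ⟨_, hint_G, _⟩ := mul_integral_tmplG_eq (M := M) hS hR hδ hδ1 hs
  have hC : 0 ≤ C := by
    have h := hPiG 1 le_rfl; rw [Real.log_one, add_zero, mul_one] at h; exact (abs_nonneg _).trans h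
  have hmeas : AEStronglyMeasurable (fun x : ℝ ↦ ((P.riemannPrimeCount x - tmplG R S δ M x : ℝ) : ℂ) * (x : ℂ) ^ (-s - 1))
      (volume.restrict (Ioi 1)) :=
    ((Complex.measurable_ofReal.comp (P.measurable_riemannPrimeCount.sub (continuous_tmplG hδ hδ1).measurable)).mul
      ((Complex.measurable_ofReal.comp measurable_id).pow_const _)).aestronglyMeasurable
  have hdiff : IntegrableOn (fun x : ℝ ↦ ((P.riemannPrimeCount x - tmplG R S δ M x : ℝ) : ℂ) * (x : ℂ) ^ (-s - 1)) (Ioi 1) := by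
    refine Integrable.mono' ((integrableOn_Ioi_rpow_of_lt (by linarith : -s.re < -1) one_pos).const_mul (2 * C)) hmeas ?_
    rw [ae_restrict_iff' measurableSet_Ioi]
    refine Eventually.of_forall fun x hx ↦ ?_
    have hx1 : (1 : ℝ) < x := hx
    have hx0 : 0 < x := by linarith
    rw [norm_mul, Complex.norm_real, Real.norm_eq_abs, norm_cpow_eq_rpow_re_of_pos hx0, sub_re, neg_re, one_re]
    have h1 := hPiG x hx1.le
    have hlog : Real.log x ≤ x := (Real.log_le_sub_one_of_pos hx0).trans (by linarith)
    calc |P.riemannPrimeCount x - tmplG R S δ M x| * x ^ (-s.re - 1) ≤ C * (1 + Real.log x) * x ^ (-s.re - 1) :=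
          mul_le_mul_of_nonneg_right h1 (Real.rpow_nonneg hx0.le _)
      _ ≤ C * (2 * x) * x ^ (-s.re - 1) := by gcongr; linarith
      _ = 2 * C * x ^ (-s.re) := by rw [Real.rpow_sub_one hx0.ne']; field_simp
  have h := hdiff.add hint_G
  refine h.congr ?_
  exact Eventually.of_forall fun x ↦ by simp only [Pi.add_apply]; push_cast; ring

/-- **`Z(s) = Σ_j log((1 − λ_j^{−s})⁻¹) − ∫_1^∞ g(u) u^{−s} du`** for `Re s > 1`. [cite: BrouckeDebruyneRevesz2023, proof of Theorem 3.2] -/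
theorem Zfn_eq_tsum_log_sub_integral (hS : ∀ ω ∈ S, ω.re ≤ 1) (hR : ∀ ρ ∈ R, ρ.re ≤ 1) (hδ : 0 ≤ δ) (hδ1 : δ ≤ 1)
    {C : ℝ} (hPiG : ∀ x : ℝ, 1 ≤ x → |P.riemannPrimeCount x - tmplG R S δ M x| ≤ C * (1 + Real.log x))
    (hsum : ∀ σ : ℝ, 1 < σ → Summable fun j ↦ P.prime j ^ (-σ)) {s : ℂ} (hs : 1 < s.re) :
    Zfn R S δ M P s = (∑' j, Complex.log ((1 - ((P.prime j : ℝ) : ℂ) ^ (-s))⁻¹)) -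
      ∫ u in Ioi (1 : ℝ), (densG R S δ M u : ℂ) * (u : ℂ) ^ (-s) := by
  have hs0 : 0 < s.re := by linarith
  obtain ⟨_, hint_G, hparts⟩ := mul_integral_tmplG_eq (M := M) hS hR hδ hδ1 hs
  have hintPi := integrableOn_riemannPrimeCount_mul_cpow (P := P) hS hR hδ hδ1 hPiG hs
  rw [← mul_integral_riemannPrimeCount_eq_tsum_log P hs0 (hsum s.re hs), ← hparts, Zfn, ← mul_sub,
    ← integral_sub hintPi hint_G]
  congr 1
  refine setIntegral_congr_fun measurableSet_Ioi fun x _ ↦ ?_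
  push_cast; ring

/-- `∫_1^∞ (densF − f_a)(u) u^{−s} du = V(s)` (and the integrand is integrable). [folklore] -/
theorem integral_densF_sub_fTrunc (hS : ∀ ω ∈ S, ω.re ≤ 1) (hR : ∀ ρ ∈ R, ρ.re ≤ 1) (hδ : 0 ≤ δ) (hδ1 : δ ≤ 1)
    (hpos : ∀ L : ℝ, 0 < L → 0 ≤ NF R S δ M L) (s : ℂ) :
    IntegrableOn (fun u : ℝ ↦ ((densF R S δ M u - fTrunc R S δ M u : ℝ) : ℂ) * (u : ℂ) ^ (-s)) (Ioi 1) ∧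
    ∫ u in Ioi (1 : ℝ), ((densF R S δ M u - fTrunc R S δ M u : ℝ) : ℂ) * (u : ℂ) ^ (-s) = Vfn R S δ M s := by
  have heq : ∀ u ∈ Ioi (1 : ℝ), ((densF R S δ M u - fTrunc R S δ M u : ℝ) : ℂ) * (u : ℂ) ^ (-s) =
      (Iic (u0 R S M)).indicator (fun u : ℝ ↦ (densF R S δ M u : ℂ) * (u : ℂ) ^ (-s)) u := by
    intro u _
    by_cases h : u ≤ u0 R S M
    · rw [indicator_of_mem (mem_Iic.2 h), fTrunc, if_neg (not_lt.2 h), sub_zero]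
    · rw [indicator_of_notMem (show u ∉ Iic (u0 R S M) from fun h' ↦ h (mem_Iic.1 h')),
        (abs_densF_sub_fTrunc_le hS hR hδ hδ1 hpos u).2 (not_le.1 h)]
      simp
  have hIoc := integrableOn_densF_mul_cpow_Ioc (M := M) hS hR hδ hδ1 hpos s
  have hind : IntegrableOn ((Iic (u0 R S M)).indicator fun u : ℝ ↦ (densF R S δ M u : ℂ) * (u : ℂ) ^ (-s)) (Ioi 1) := by
    rw [integrableOn_indicator_iff measurableSet_Iic, Iic_inter_Ioi]
    exact hIoc
  refine ⟨hind.congr_fun (fun u hu ↦ (heq u hu).symm) measurableSet_Ioi, ?_⟩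
  rw [setIntegral_congr_fun measurableSet_Ioi heq, setIntegral_indicator measurableSet_Iic, Ioi_inter_Iic, Vfn]

/-- **`Z = BV.Z f_a g_a 𝒫 − V` on `Re s > 1`.** [cite: BrouckeDebruyneRevesz2023, proof of Theorem 3.2] -/
theorem Zfn_eq_bvZ_sub_Vfn_of_one_lt (hS : ∀ ω ∈ S, ω.re ≤ 1) (hR : ∀ ρ ∈ R, ρ.re ≤ 1) (hδ : 0 ≤ δ) (hδ1 : δ ≤ 1)
    (hpos : ∀ L : ℝ, 0 < L → 0 ≤ NF R S δ M L) (hA : BV.Approx (densF R S δ M) P A) {C : ℝ}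
    (hPiG : ∀ x : ℝ, 1 ≤ x → |P.riemannPrimeCount x - tmplG R S δ M x| ≤ C * (1 + Real.log x))
    {s : ℂ} (hs : 1 < s.re) :
    Zfn R S δ M P s = BV.Z (fTrunc R S δ M) (gTrunc R S δ M) P s - Vfn R S δ M s := by
  have hA' := approx_fTrunc hS hR hδ hδ1 hpos hA
  have hfm := measurable_fTrunc (R := R) (S := S) (δ := δ) (M := M) hδ hδ1
  have hgm := measurable_gTrunc (R := R) (S := S) (δ := δ) (M := M) hδ hδ1
  have hf := abs_fTrunc_le_two (M := M) hS hR hδ hδ1 hpos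
  have hgf := gTrunc_sub_fTrunc_bounds (M := M) hS hR hδ hδ1 hpos
  have hsum : ∀ σ : ℝ, 1 < σ → Summable fun j ↦ P.prime j ^ (-σ) := fun σ hσ ↦ hA'.summable_prime_rpow_neg hf hσ
  -- `BV.Z = Σ log − ∫ g_a u^{−s}`
  have hE2 := BV.E₂_eq hA' hfm hf hs
  obtain ⟨hgint, hfg⟩ := BV.integral_f_cpow_eq hfm hf hgm hgf hs
  have hlog := hA'.tsum_log_eulerFactor_eq hf hs
  have hZ : BV.Z (fTrunc R S δ M) (gTrunc R S δ M) P s = (∑' j, Complex.log ((1 - ((P.prime j : ℝ) : ℂ) ^ (-s))⁻¹)) -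
      ∫ u in Ioi (1 : ℝ), (gTrunc R S δ M u : ℂ) * (u : ℂ) ^ (-s) := by
    rw [BV.Z, hE2, hlog, hfg]; ring
  -- `∫ g_a u^{−s} = ∫ densG u^{−s} − V`
  obtain ⟨hint_g, _, _⟩ := mul_integral_tmplG_eq (M := M) hS hR hδ hδ1 hs
  obtain ⟨hVint, hV⟩ := integral_densF_sub_fTrunc (M := M) hS hR hδ hδ1 hpos s
  have hga : ∫ u in Ioi (1 : ℝ), (gTrunc R S δ M u : ℂ) * (u : ℂ) ^ (-s) =
      (∫ u in Ioi (1 : ℝ), (densG R S δ M u : ℂ) * (u : ℂ) ^ (-s)) - Vfn R S δ M s := by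
    rw [← hV, ← integral_sub hint_g hVint]
    refine setIntegral_congr_fun measurableSet_Ioi fun u _ ↦ ?_
    simp only [gTrunc]; push_cast; ring
  rw [Zfn_eq_tsum_log_sub_integral hS hR hδ hδ1 hPiG hsum hs, hZ, hga]
  ring

/-- **`Z = BV.Z f_a g_a 𝒫 − V` on `Re s > 1/2`** (identity theorem: both sides holomorphic there, equal on `Re s > 1`).
[cite: BrouckeDebruyneRevesz2023, proof of Theorem 3.2] -/
theorem Zfn_eq_bvZ_sub_Vfn (hS : ∀ ω ∈ S, ω.re ≤ 1) (hR : ∀ ρ ∈ R, ρ.re ≤ 1) (hδ : 0 ≤ δ) (hδ1 : δ ≤ 1)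
    (hpos : ∀ L : ℝ, 0 < L → 0 ≤ NF R S δ M L) (hA : BV.Approx (densF R S δ M) P A) {C : ℝ}
    (hPiG : ∀ x : ℝ, 1 ≤ x → |P.riemannPrimeCount x - tmplG R S δ M x| ≤ C * (1 + Real.log x))
    {s : ℂ} (hs : 1 / 2 < s.re) :
    Zfn R S δ M P s = BV.Z (fTrunc R S δ M) (gTrunc R S δ M) P s - Vfn R S δ M s := by
  have hA' := approx_fTrunc hS hR hδ hδ1 hpos hA
  have hfm := measurable_fTrunc (R := R) (S := S) (δ := δ) (M := M) hδ hδ1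
  have hgm := measurable_gTrunc (R := R) (S := S) (δ := δ) (M := M) hδ hδ1
  have hf := abs_fTrunc_le_two (M := M) hS hR hδ hδ1 hpos
  have hgf := gTrunc_sub_fTrunc_bounds (M := M) hS hR hδ hδ1 hpos
  set U : Set ℂ := {w : ℂ | 1 / 2 < w.re} with hU
  have hUo : IsOpen U := isOpen_lt continuous_const Complex.continuous_re
  have hUconn : IsPreconnected U := (convex_halfSpace_re_gt (1 / 2)).isPreconnected
  set F₁ : ℂ → ℂ := Zfn R S δ M P with hF₁
  set F₂ : ℂ → ℂ := fun w ↦ BV.Z (fTrunc R S δ M) (gTrunc R S δ M) P w - Vfn R S δ M w with hF₂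
  have h1 : AnalyticOnNhd ℂ F₁ U := by
    have hd : DifferentiableOn ℂ F₁ U := (differentiableOn_Zfn hδ hδ1 hPiG).mono fun w hw ↦ by
      simp only [hU, mem_setOf_eq] at hw ⊢; linarith
    exact hd.analyticOnNhd hUo
  have h2 : AnalyticOnNhd ℂ F₂ U := by
    have hd : DifferentiableOn ℂ F₂ U :=
      (BV.differentiableOn_Z hA' hfm hf hgm hgf).sub (differentiable_Vfn hS hR hδ hδ1 hpos).differentiableOn
    exact hd.analyticOnNhd hUo
  have h2mem : (2 : ℂ) ∈ U := by show (1 / 2 : ℝ) < (2 : ℂ).re; norm_num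
  have heq : F₁ =ᶠ[𝓝 (2 : ℂ)] F₂ := by
    have hV : {w : ℂ | 1 < w.re} ∈ 𝓝 (2 : ℂ) :=
      (isOpen_lt continuous_const Complex.continuous_re).mem_nhds (by show (1 : ℝ) < (2 : ℂ).re; norm_num)
    filter_upwards [hV] with w hw
    exact Zfn_eq_bvZ_sub_Vfn_of_one_lt hS hR hδ hδ1 hpos hA hPiG hw
  exact h1.eqOn_of_preconnected_of_eventuallyEq h2 hUconn h2mem heq hs

/-! ### The bound (3.4) -/

/-- The trivial bound far to the right: for `Re s ≥ 2`,
`‖Z(s)‖ ≤ Σ_{(j,k)} λ_j^{−2(k+1)}/(k+1) + C_g`. [cite: BrouckeDebruyneRevesz2023, proof of Theorem 3.2] -/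
theorem norm_Zfn_le_of_two_le (hS : ∀ ω ∈ S, ω.re ≤ 1) (hR : ∀ ρ ∈ R, ρ.re ≤ 1) (hδ : 0 ≤ δ) (hδ1 : δ ≤ 1) {C : ℝ}
    (hPiG : ∀ x : ℝ, 1 ≤ x → |P.riemannPrimeCount x - tmplG R S δ M x| ≤ C * (1 + Real.log x))
    (hsum : ∀ σ : ℝ, 1 < σ → Summable fun j ↦ P.prime j ^ (-σ)) {s : ℂ} (hs : 2 ≤ s.re) :
    ‖Zfn R S δ M P s‖ ≤ (∑' jk : ℕ × ℕ, 1 / ((jk.2 : ℝ) + 1) * (P.prime jk.1 ^ (jk.2 + 1)) ^ (-(2 : ℝ))) +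
      (sizeBound R S M * normBound R S * Real.exp (normBound R S) + (1 + 2 * Multiset.card S + 2 * Multiset.card R + M)) := by
  have hs1 : 1 < s.re := by linarith
  have hs0 : 0 < s.re := by linarith
  rw [Zfn_eq_tsum_log_sub_integral hS hR hδ hδ1 hPiG hsum hs1, ← mul_integral_riemannPrimeCount_eq_tsum_log P hs0 (hsum s.re hs1),
    P.mul_integral_riemannPrimeCount_eq_tsum hs0 (hsum s.re hs1)]
  refine (norm_sub_le _ _).trans (add_le_add ?_ ?_)
  · -- the prime-power sum
    have hw2 := summable_primePow_weight P two_pos (hsum 2 one_lt_two)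
    refine tsum_of_norm_bounded hw2.hasSum fun jk ↦ ?_
    have hq : (1 : ℝ) ≤ P.prime jk.1 ^ (jk.2 + 1) := one_le_pow₀ (P.one_lt_prime jk.1).le
    rw [norm_mul, Complex.norm_real, Real.norm_eq_abs, abs_of_nonneg (by positivity),
      norm_cpow_eq_rpow_re_of_pos (by positivity) , neg_re]
    exact mul_le_mul_of_nonneg_left (Real.rpow_le_rpow_of_exponent_le hq (by linarith)) (by positivity)
  · -- the template integral
    set Cg : ℝ := sizeBound R S M * normBound R S * Real.exp (normBound R S) +
      (1 + 2 * Multiset.card S + 2 * Multiset.card R + M) with hCg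
    have hint : IntegrableOn (fun u : ℝ ↦ Cg * u ^ (-(2 : ℝ))) (Ioi 1) := (integrableOn_Ioi_rpow_of_lt (by norm_num) one_pos).const_mul _
    have hle : ∀ u ∈ Ioi (1 : ℝ), ‖(densG R S δ M u : ℂ) * (u : ℂ) ^ (-s)‖ ≤ Cg * u ^ (-(2 : ℝ)) := by
      intro u hu
      have hu1 : (1 : ℝ) < u := hu
      have hu0 : 0 < u := by linarith
      rw [norm_mul, Complex.norm_real, Real.norm_eq_abs, norm_cpow_eq_rpow_re_of_pos hu0, neg_re]
      exact mul_le_mul (abs_densG_le hS hR hδ hδ1 u) (Real.rpow_le_rpow_of_exponent_le hu1.le (by linarith))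
        (Real.rpow_nonneg hu0.le _) (by rw [hCg]; have := sizeBound_nonneg (R := R) (S := S) (M := M); have := normBound_nonneg (R := R) (S := S); positivity)
    calc ‖∫ u in Ioi (1 : ℝ), (densG R S δ M u : ℂ) * (u : ℂ) ^ (-s)‖ ≤ ∫ u in Ioi (1 : ℝ), Cg * u ^ (-(2 : ℝ)) :=
          norm_integral_le_of_norm_le hint (by
            rw [ae_restrict_iff' measurableSet_Ioi]; exact Eventually.of_forall hle)
      _ = Cg := by
          rw [MeasureTheory.integral_const_mul, integral_Ioi_rpow_of_lt (by norm_num) one_pos]; norm_num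

/-- **BDR (3.4): `Z(σ+it) ≪ σ/(σ−1/2) + σ√(log(|t|+1)/(σ−1/2))` for all `σ > 1/2`, `t ∈ ℝ`, with one constant.**
Hypotheses: the template data of Theorem 3.2 (`Re ω, Re ρ ≤ 1`, `0 ≤ δ ≤ 1`, `NF ≥ 0` on `(0,∞)`), (1.3) for the
template density in the form `BV.Approx densF 𝒫 A`, and `|Π_𝒫 − G| ≤ C(1 + log x)`.
[cite: BrouckeDebruyneRevesz2023, Theorem 3.2 (3.4) and its proof] -/
theorem norm_Zfn_le (hS : ∀ ω ∈ S, ω.re ≤ 1) (hR : ∀ ρ ∈ R, ρ.re ≤ 1) (hδ : 0 ≤ δ) (hδ1 : δ ≤ 1)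
    (hpos : ∀ L : ℝ, 0 < L → 0 ≤ NF R S δ M L) (hA : BV.Approx (densF R S δ M) P A) {C : ℝ}
    (hPiG : ∀ x : ℝ, 1 ≤ x → |P.riemannPrimeCount x - tmplG R S δ M x| ≤ C * (1 + Real.log x)) :
    ∃ C' : ℝ, ∀ σ t : ℝ, 1 / 2 < σ →
      ‖Zfn R S δ M P (σ + t * I)‖ ≤ C' * (σ / (σ - 1 / 2) + σ * Real.sqrt (Real.log (|t| + 1) / (σ - 1 / 2))) := by
  have hA' := approx_fTrunc hS hR hδ hδ1 hpos hA
  have hfm := measurable_fTrunc (R := R) (S := S) (δ := δ) (M := M) hδ hδ1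
  have hgm := measurable_gTrunc (R := R) (S := S) (δ := δ) (M := M) hδ hδ1
  have hf := abs_fTrunc_le_two (M := M) hS hR hδ hδ1 hpos
  have hgf := gTrunc_sub_fTrunc_bounds (M := M) hS hR hδ hδ1 hpos
  have hsum : ∀ σ : ℝ, 1 < σ → Summable fun j ↦ P.prime j ^ (-σ) := fun σ hσ ↦ hA'.summable_prime_rpow_neg hf hσ
  have hA'0 := hA'.nonneg
  have hCg := Cglob_nonneg (R := R) (S := S) (M := M)
  have hu0 := one_lt_u0 (R := R) (S := S) (M := M)
  -- the BV constant
  have hZb : ∃ Cbv : ℝ, 0 ≤ Cbv ∧ ∀ s : ℂ, 1 / 2 < s.re → s.re ≤ 2 →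
      ‖BV.Z (fTrunc R S δ M) (gTrunc R S δ M) P s‖ ≤
        Cbv * (1 / (s.re - 1 / 2) + Real.sqrt (Real.log (|s.im| + 1)) / Real.sqrt (s.re - 1 / 2)) := by
    refine ⟨_, ?_, fun s hs hs2 ↦ BV.norm_Z_le hA' hfm hf hgm hgf hs hs2⟩
    have hK₀ := BV.E₁const_nonneg P
    have h4 : 0 ≤ (2 + (A + Cglob R S M * (u0 R S M - 1))) ^ (4 : ℝ) := Real.rpow_nonneg (by linarith) _
    exact add_nonneg (add_nonneg (add_nonneg (mul_nonneg two_pos.le (mul_nonneg hK₀ h4)) (mul_nonneg two_pos.le hA'0)) hCg)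
      (mul_nonneg (mul_nonneg two_pos.le hA'0) (Real.sqrt_nonneg _))
  obtain ⟨Cbv, hCbv0, hZb⟩ := hZb
  set V0 : ℝ := Cglob R S M * (u0 R S M - 1) with hV0
  have hV00 : 0 ≤ V0 := mul_nonneg hCg (by linarith)
  set W : ℝ := (∑' jk : ℕ × ℕ, 1 / ((jk.2 : ℝ) + 1) * (P.prime jk.1 ^ (jk.2 + 1)) ^ (-(2 : ℝ))) +
    (sizeBound R S M * normBound R S * Real.exp (normBound R S) + (1 + 2 * Multiset.card S + 2 * Multiset.card R + M)) with hW
  have hW0 : 0 ≤ W := by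
    have h1 : 0 ≤ ∑' jk : ℕ × ℕ, 1 / ((jk.2 : ℝ) + 1) * (P.prime jk.1 ^ (jk.2 + 1)) ^ (-(2 : ℝ)) :=
      tsum_nonneg fun jk ↦ by have := P.prime_pos jk.1; positivity
    have hB := sizeBound_nonneg (R := R) (S := S) (M := M)
    have hQ := normBound_nonneg (R := R) (S := S)
    positivity
  refine ⟨2 * Cbv + 2 * V0 + W, fun σ t hσ ↦ ?_⟩
  set s : ℂ := σ + t * I with hsdef
  have hsre : s.re = σ := by simp [hsdef]
  have hsim : s.im = t := by simp [hsdef]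
  have hε : 0 < σ - 1 / 2 := by linarith
  have hratio : 1 ≤ σ / (σ - 1 / 2) := by rw [le_div_iff₀ hε]; linarith
  have hsq0 : 0 ≤ Real.sqrt (Real.log (|t| + 1) / (σ - 1 / 2)) := Real.sqrt_nonneg _
  have hbr0 : 0 ≤ σ / (σ - 1 / 2) + σ * Real.sqrt (Real.log (|t| + 1) / (σ - 1 / 2)) := by
    have : 0 ≤ σ * Real.sqrt (Real.log (|t| + 1) / (σ - 1 / 2)) := mul_nonneg (by linarith) hsq0
    linarith
  rcases le_or_gt σ 2 with hσ2 | hσ2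
  · -- `σ ≤ 2`: BV's bound plus the correction `V`
    have hZ := Zfn_eq_bvZ_sub_Vfn hS hR hδ hδ1 hpos hA hPiG (s := s) (by rw [hsre]; exact hσ)
    have hb := hZb s (by rw [hsre]; exact hσ) (by rw [hsre]; exact hσ2)
    rw [hsre, hsim] at hb
    have hV := norm_Vfn_le (M := M) hS hR hδ hδ1 hpos (s := s) (by rw [hsre]; linarith)
    have hsqrt : Real.sqrt (Real.log (|t| + 1)) / Real.sqrt (σ - 1 / 2) = Real.sqrt (Real.log (|t| + 1) / (σ - 1 / 2)) := by
      rw [Real.sqrt_div' _ hε.le]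
    rw [hsqrt] at hb
    have hinv : 1 / (σ - 1 / 2) ≤ 2 * (σ / (σ - 1 / 2)) := by
      rw [mul_div_assoc', div_le_div_iff_of_pos_right hε]; linarith
    have hsq : Real.sqrt (Real.log (|t| + 1) / (σ - 1 / 2)) ≤ 2 * (σ * Real.sqrt (Real.log (|t| + 1) / (σ - 1 / 2))) := by
      nlinarith
    calc ‖Zfn R S δ M P s‖ = ‖BV.Z (fTrunc R S δ M) (gTrunc R S δ M) P s - Vfn R S δ M s‖ := by rw [hZ]
      _ ≤ ‖BV.Z (fTrunc R S δ M) (gTrunc R S δ M) P s‖ + ‖Vfn R S δ M s‖ := norm_sub_le _ _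
      _ ≤ Cbv * (1 / (σ - 1 / 2) + Real.sqrt (Real.log (|t| + 1) / (σ - 1 / 2))) + V0 := add_le_add hb hV
      _ ≤ Cbv * (2 * (σ / (σ - 1 / 2) + σ * Real.sqrt (Real.log (|t| + 1) / (σ - 1 / 2)))) + V0 * (2 * (σ / (σ - 1 / 2))) := by
          refine add_le_add (mul_le_mul_of_nonneg_left (by linarith) hCbv0) ?_
          nlinarith
      _ ≤ (2 * Cbv + 2 * V0 + W) * (σ / (σ - 1 / 2) + σ * Real.sqrt (Real.log (|t| + 1) / (σ - 1 / 2))) := by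
          have := mul_nonneg hW0 hbr0
          have := mul_nonneg hV00 (mul_nonneg (by linarith : (0:ℝ) ≤ σ) hsq0)
          nlinarith
  · -- `σ > 2`: absolute convergence
    have hb := norm_Zfn_le_of_two_le (M := M) hS hR hδ hδ1 hPiG hsum (s := s) (by rw [hsre]; exact hσ2.le)
    rw [← hW] at hb
    calc ‖Zfn R S δ M P s‖ ≤ W := hb
      _ ≤ W * (σ / (σ - 1 / 2) + σ * Real.sqrt (Real.log (|t| + 1) / (σ - 1 / 2))) := by
          have : 0 ≤ σ * Real.sqrt (Real.log (|t| + 1) / (σ - 1 / 2)) := mul_nonneg (by linarith) hsq0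
          nlinarith
      _ ≤ (2 * Cbv + 2 * V0 + W) * (σ / (σ - 1 / 2) + σ * Real.sqrt (Real.log (|t| + 1) / (σ - 1 / 2))) := by
          have : 0 ≤ (2 * Cbv + 2 * V0) := by positivity
          nlinarith

end BDRMultiset

end Literature.NumberTheory.BeurlingPrimes
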